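import Literature.Analysis.FluidPDE.TsaiWeightedRieszPressureProofs
import HarnessLib

/-!
# The whole-space pressure of an `L³` velocity field

Given Stein's `L^p` bound for the normalised pressure `p̃[w] = R_i R_j (w_i w_j)` of test fields
(`stein1970_normalisedPressure_Lp_bound`, used at `p = 3/2`), every `U ∈ L³(ℝ³; ℝ³)` carries a
pressure `P ∈ L^{3/2}(ℝ³)` with `‖P‖_{3/2} ≤ C ‖U‖₃²` solving `-Δ P = div div (U ⊗ U)` in the
sense of distributions, `∫ P Δφ = -∫ D²φ(U, U)` for every test function `φ`
(`exists_wholeSpacePressure_of_stein`).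

This is the whole-space component `p₁` of the standard splitting `p = p₁ + p₂` of the pressure
on a ball (`Δ p₁ = -div div (χ_B u ⊗ u)` in `ℝ³`, `‖p₁‖_{3/2, ℝ³} ≤ c ‖u‖²_{3, B}`, `p₂` harmonic
in `B`) behind the local pressure decay estimate of Seregin and Seregin–Šverák
(`seregin_sverak_pressure_decay` of `FluidPDE/PressureDecayEstimate`); Seregin, *Lecture notes on
regularity theory for the Navier–Stokes equations* (2014), §6.3 (proof of Prop. 3.10) and
Seregin 2005, (p9)–(p12) (there with the Dirichlet variant of `p₁`).

The construction is the approximation argument of Tsai 1998, Lemma 2.1 (p. 34), already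
implemented for the weight `|x|^{-5/3}` in `FluidPDE/TsaiWeightedRieszPressureProofs`
(`tsai1998_weightedRieszPressure_of_powerWeight`); here the unweighted exponents `(3, 3/2)` are
used: approximate `U` in `L³` by test fields `wₙ`; the pressures `p̃[wₙ]` are Cauchy in `L^{3/2}`
by the bilinear (polarisation) estimate `eLpNorm_normalisedPressure_sub_le`, converge to some
`P`, and both the norm bound and the distributional equation pass to the limit.

## Main results

- `tendsto_integral_mul_of_tendsto_eLpNorm_sub`: `Fₙ → Q` in `L^p`, `ψ ∈ L^q`, `1/p + 1/q = 1`
  ⟹ `∫ Fₙ ψ → ∫ Q ψ`.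
- `norm_integral_bilin_apply_le`: `|∫ L(x)(a(x), b(x)) dx| ≤ ‖L‖₃ ‖a‖₃ ‖b‖₃`.
- `tendsto_integral_hessian_apply_of_tendsto_eLpNorm`: `wₙ → U` in `L³`
  ⟹ `∫ D²φ(wₙ, wₙ) → ∫ D²φ(U, U)`.
- `exists_wholeSpacePressure_of_stein`: the theorem described above.

## References

- G. Seregin, *Lecture Notes on Regularity Theory for the Navier–Stokes Equations*, World
  Scientific 2014, §6.3. [Seregin2014]
- G. Seregin, *Navier–Stokes equations: almost `L_{3,∞}`-case*, J. Math. Fluid Mech. 9 (2007),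
  arXiv:math/0510396, (p9)–(p12). [Seregin2005]
- T.-P. Tsai, *On Leray's self-similar solutions of the Navier–Stokes equations satisfying local
  energy estimates*, ARMA 143 (1998), Lemma 2.1. [Tsai1998]
- E. M. Stein, *Singular Integrals and Differentiability Properties of Functions*, 1970,
  Ch. II §4.2 Thm 3. [Stein1971]
-/

noncomputable section

open MeasureTheory Set Filter Metric Topology Function
open scoped ENNReal NNReal ContDiff Laplacian

namespace Literature.Analysis.FluidPDE

/-! ## Pairings along `L^p`-convergent sequences -/

section Pairings

/-- **Linear pairing.** If `Fₙ → Q` in `L^p(μ)` (all in `L^p`) and `ψ ∈ L^q(μ)` with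
`1/p + 1/q = 1`, then `∫ Fₙ ψ dμ → ∫ Q ψ dμ` (Hölder's inequality). [folklore] -/
theorem tendsto_integral_mul_of_tendsto_eLpNorm_sub {μ : Measure (EuclideanSpace ℝ (Fin 3))}
    {p q : ℝ≥0∞}
    [p.HolderTriple q 1] {F : ℕ → EuclideanSpace ℝ (Fin 3) → ℝ} {Q : EuclideanSpace ℝ (Fin 3) → ℝ}
    (hF : ∀ n, MemLp (F n) p μ) (hQ : MemLp Q p μ)
    (hE : Tendsto (fun n => eLpNorm (F n - Q) p μ) atTop (𝓝 0))
    {ψ : EuclideanSpace ℝ (Fin 3) → ℝ} (hψ : MemLp ψ q μ) :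
    Tendsto (fun n => ∫ x, F n x * ψ x ∂μ) atTop (𝓝 (∫ x, Q x * ψ x ∂μ)) := by
  have hint : ∀ {G : EuclideanSpace ℝ (Fin 3) → ℝ}, MemLp G p μ →
      Integrable (fun x => G x * ψ x) μ := by
    intro G hG
    have h : MemLp (G * ψ) 1 μ := hψ.mul hG
    exact memLp_one_iff_integrable.1 h
  have hbound : ∀ n, ‖(∫ x, F n x * ψ x ∂μ) - ∫ x, Q x * ψ x ∂μ‖ ≤
      (eLpNorm (F n - Q) p μ * eLpNorm ψ q μ).toReal := fun n => by
    rw [← integral_sub (hint (hF n)) (hint hQ)]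
    have e : (fun x => F n x * ψ x - Q x * ψ x) = fun x => (F n - Q) x * ψ x := by
      funext x; simp only [Pi.sub_apply, sub_mul]
    rw [e]
    have hm : AEStronglyMeasurable (fun x => (F n - Q) x * ψ x) μ := ((hF n).sub hQ).1.mul hψ.1
    calc ‖∫ x, (F n - Q) x * ψ x ∂μ‖ ≤ ∫ x, ‖(F n - Q) x * ψ x‖ ∂μ :=
          norm_integral_le_integral_norm _
      _ = (eLpNorm (fun x => (F n - Q) x * ψ x) 1 μ).toReal := by
          rw [integral_norm_eq_lintegral_enorm hm, eLpNorm_one_eq_lintegral_enorm]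
      _ ≤ (eLpNorm (F n - Q) p μ * eLpNorm ψ q μ).toReal := by
          refine ENNReal.toReal_mono
            (ENNReal.mul_ne_top ((hF n).sub hQ).eLpNorm_ne_top hψ.eLpNorm_ne_top) ?_
          have h := eLpNorm_smul_le_mul_eLpNorm (p := p) (q := q) (r := 1) hψ.1 ((hF n).sub hQ).1
          have e' : ((F n - Q) • ψ) = fun x => (F n - Q) x * ψ x := by
            funext x; simp only [Pi.smul_apply', smul_eq_mul]
          rwa [e'] at h
  have hlim : Tendsto (fun n => (eLpNorm (F n - Q) p μ * eLpNorm ψ q μ).toReal) atTop (𝓝 0) := by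
    have h := ENNReal.Tendsto.mul_const hE (Or.inr hψ.eLpNorm_ne_top)
    rw [zero_mul] at h
    have h' := (ENNReal.tendsto_toReal ENNReal.zero_ne_top).comp h
    rwa [ENNReal.toReal_zero] at h'
  exact tendsto_iff_norm_sub_tendsto_zero.2 (squeeze_zero (fun n => norm_nonneg _) hbound hlim)

-- nested operator types `ℝ³ →L[ℝ] ℝ³ →L[ℝ] ℝ` (curried second derivatives)
set_option maxSynthPendingDepth 3 in
/-- **Trilinear Hölder bound.** For `L ∈ L³(ℝ³; ℝ³ →L ℝ³ →L ℝ)` and fields `a, b ∈ L³`, the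
pairing `x ↦ L(x)(a(x), b(x))` is integrable and `|∫ L(a, b)| ≤ ‖L‖₃ ‖a‖₃ ‖b‖₃`
(Hölder with `1/3 + 1/3 + 1/3 = 1`). [folklore] -/
theorem norm_integral_bilin_apply_le
    {L : EuclideanSpace ℝ (Fin 3) → EuclideanSpace ℝ (Fin 3) →L[ℝ] EuclideanSpace ℝ (Fin 3) →L[ℝ] ℝ}
    (hL : MemLp L 3 volume) {a b : EuclideanSpace ℝ (Fin 3) → EuclideanSpace ℝ (Fin 3)}
    (ha : MemLp a 3 volume) (hb : MemLp b 3 volume) :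
    Integrable (fun x => L x (a x) (b x)) ∧
      ‖∫ x, L x (a x) (b x)‖ ≤
        (eLpNorm L 3 volume).toReal * (eLpNorm a 3 volume).toReal *
          (eLpNorm b 3 volume).toReal := by
  -- the Hölder triples `(3, 3, 3/2)` and `(3/2, 3, 1)`
  have hT₁ : ENNReal.HolderTriple 3 3 (3 / 2) := by
    constructor
    rw [ENNReal.inv_div (Or.inr (by norm_num)) (Or.inr (by norm_num)), ← two_mul, div_eq_mul_inv]
  have h23 : (2 : ℝ≥0∞) / 3 + 3⁻¹ = 1 := by
    rw [show (3 : ℝ≥0∞)⁻¹ = 1 / 3 by rw [one_div], ENNReal.div_add_div_same,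
      show (2 : ℝ≥0∞) + 1 = 3 by norm_num]
    exact ENNReal.div_self (by norm_num) (by norm_num)
  have hT₂ : ENNReal.HolderTriple (3 / 2) 3 1 := by
    constructor
    rw [ENNReal.inv_div (Or.inr (by norm_num)) (Or.inr (by norm_num)), inv_one, h23]
  -- first contraction: `x ↦ L(x)(a(x)) ∈ L^{3/2}`
  have h1m : MemLp (fun x => L x (a x)) (3 / 2) volume := by
    simpa only [ContinuousLinearMap.id_apply] using
      (ContinuousLinearMap.id ℝ
        (EuclideanSpace ℝ (Fin 3) →L[ℝ] EuclideanSpace ℝ (Fin 3) →L[ℝ] ℝ)).memLp_of_bilin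
        (3 / 2) hL ha
  have h1 : eLpNorm (fun x => L x (a x)) (3 / 2) volume ≤
      eLpNorm L 3 volume * eLpNorm a 3 volume := by
    have h := eLpNorm_le_eLpNorm_mul_eLpNorm'_of_norm (p := 3) (q := 3) (r := 3 / 2) hL.1 ha.1
      (fun (S : EuclideanSpace ℝ (Fin 3) →L[ℝ] EuclideanSpace ℝ (Fin 3) →L[ℝ] ℝ)
        (v : EuclideanSpace ℝ (Fin 3)) => S v) 1
      (Eventually.of_forall fun x => by
        simpa only [NNReal.coe_one, one_mul] using (L x).le_opNorm (a x))
    simpa only [ENNReal.coe_one, one_mul] using h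
  -- second contraction: `x ↦ L(x)(a(x), b(x)) ∈ L¹`
  have h2m : MemLp (fun x => L x (a x) (b x)) 1 volume := by
    simpa only [ContinuousLinearMap.id_apply] using
      (ContinuousLinearMap.id ℝ (EuclideanSpace ℝ (Fin 3) →L[ℝ] ℝ)).memLp_of_bilin 1 h1m hb
  have h2 : eLpNorm (fun x => L x (a x) (b x)) 1 volume ≤
      eLpNorm (fun x => L x (a x)) (3 / 2) volume * eLpNorm b 3 volume := by
    have h := eLpNorm_le_eLpNorm_mul_eLpNorm'_of_norm (p := 3 / 2) (q := 3) (r := 1) h1m.1 hb.1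
      (fun (T : EuclideanSpace ℝ (Fin 3) →L[ℝ] ℝ) (v : EuclideanSpace ℝ (Fin 3)) => T v) 1
      (Eventually.of_forall fun x => by
        simpa only [NNReal.coe_one, one_mul] using (L x (a x)).le_opNorm (b x))
    simpa only [ENNReal.coe_one, one_mul] using h
  refine ⟨memLp_one_iff_integrable.1 h2m, ?_⟩
  calc ‖∫ x, L x (a x) (b x)‖ ≤ ∫ x, ‖L x (a x) (b x)‖ := norm_integral_le_integral_norm _
    _ = (eLpNorm (fun x => L x (a x) (b x)) 1 volume).toReal := by
        rw [integral_norm_eq_lintegral_enorm h2m.1, eLpNorm_one_eq_lintegral_enorm]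
    _ ≤ (eLpNorm L 3 volume * eLpNorm a 3 volume * eLpNorm b 3 volume).toReal := by
        refine ENNReal.toReal_mono (ENNReal.mul_ne_top
          (ENNReal.mul_ne_top hL.eLpNorm_ne_top ha.eLpNorm_ne_top) hb.eLpNorm_ne_top) ?_
        exact h2.trans (mul_le_mul_left h1 _)
    _ = _ := by rw [ENNReal.toReal_mul, ENNReal.toReal_mul]

-- nested operator types `ℝ³ →L[ℝ] ℝ³ →L[ℝ] ℝ` (curried second derivatives)
set_option maxSynthPendingDepth 3 in
/-- **Quadratic pairing.** If `wₙ → U` in `L³(ℝ³; ℝ³)` then `∫ D²φ(wₙ, wₙ) → ∫ D²φ(U, U)` for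
every test function `φ`: `D²φ(a,a) − D²φ(b,b) = D²φ(a − b, a) + D²φ(b, a − b)` and the trilinear
Hölder bound `norm_integral_bilin_apply_le`. (The `L³` analogue of
`tendsto_integral_hessian_apply`; cf. Tsai 1998, proof of Lemma 2.1, "we then extend this result
to general `U` by approximation".) [cite: Tsai1998, Lemma 2.1 proof (p. 34)] -/
theorem tendsto_integral_hessian_apply_of_tendsto_eLpNorm
    {w : ℕ → EuclideanSpace ℝ (Fin 3) → EuclideanSpace ℝ (Fin 3)}
    {U : EuclideanSpace ℝ (Fin 3) → EuclideanSpace ℝ (Fin 3)}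
    (hw : ∀ n, MemLp (w n) 3 volume) (hU : MemLp U 3 volume)
    (hT : Tendsto (fun n => eLpNorm (w n - U) 3 volume) atTop (𝓝 0))
    {φ : EuclideanSpace ℝ (Fin 3) → ℝ} (hφ : ContDiff ℝ (⊤ : ℕ∞) φ) (hφc : HasCompactSupport φ) :
    Tendsto (fun n => ∫ x, fderiv ℝ (fderiv ℝ φ) x (w n x) (w n x)) atTop
      (𝓝 (∫ x, fderiv ℝ (fderiv ℝ φ) x (U x) (U x))) := by
  set L : EuclideanSpace ℝ (Fin 3) →
      EuclideanSpace ℝ (Fin 3) →L[ℝ] EuclideanSpace ℝ (Fin 3) →L[ℝ] ℝ := fderiv ℝ (fderiv ℝ φ)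
    with hL_def
  have hφ2 : ContDiff ℝ 2 φ := contDiff_infty.1 hφ 2
  have hLc : Continuous L :=
    (hφ2.fderiv_right (m := 1) (by norm_num)).continuous_fderiv one_ne_zero
  have hLs : HasCompactSupport L := (hφc.fderiv (𝕜 := ℝ)).fderiv (𝕜 := ℝ)
  have hLm : MemLp L 3 volume := hLc.memLp_of_hasCompactSupport hLs
  set M : ℝ := (eLpNorm L 3 volume).toReal with hM_def
  set T : ℕ → ℝ := fun n => (eLpNorm (w n - U) 3 volume).toReal with hT_def
  set u : ℝ := (eLpNorm U 3 volume).toReal with hu_def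
  have hT' : Tendsto T atTop (𝓝 0) := by
    have h := (ENNReal.tendsto_toReal ENNReal.zero_ne_top).comp hT
    rwa [ENNReal.toReal_zero] at h
  -- `‖wₙ‖₃ ≤ ‖wₙ - U‖₃ + ‖U‖₃`
  have hwn : ∀ n, (eLpNorm (w n) 3 volume).toReal ≤ T n + u := fun n => by
    have e : w n = (w n - U) + U := by abel
    have h : eLpNorm (w n) 3 volume ≤ eLpNorm (w n - U) 3 volume + eLpNorm U 3 volume := by
      conv_lhs => rw [e]
      exact eLpNorm_add_le ((hw n).sub hU).1 hU.1 (by norm_num)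
    calc (eLpNorm (w n) 3 volume).toReal
        ≤ (eLpNorm (w n - U) 3 volume + eLpNorm U 3 volume).toReal :=
          ENNReal.toReal_mono
            (ENNReal.add_ne_top.2 ⟨((hw n).sub hU).eLpNorm_ne_top, hU.eLpNorm_ne_top⟩) h
      _ = T n + u := ENNReal.toReal_add ((hw n).sub hU).eLpNorm_ne_top hU.eLpNorm_ne_top
  -- the difference of the pairings
  have hbound : ∀ n, ‖(∫ x, L x (w n x) (w n x)) - ∫ x, L x (U x) (U x)‖ ≤
      M * T n * (T n + u) + M * u * T n := by
    intro n
    obtain ⟨hi1, hb1⟩ := norm_integral_bilin_apply_le hLm ((hw n).sub hU) (hw n)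
    obtain ⟨hi2, hb2⟩ := norm_integral_bilin_apply_le hLm hU ((hw n).sub hU)
    obtain ⟨hiw, -⟩ := norm_integral_bilin_apply_le hLm (hw n) (hw n)
    obtain ⟨hiU, -⟩ := norm_integral_bilin_apply_le hLm hU hU
    have e : (∫ x, L x (w n x) (w n x)) - ∫ x, L x (U x) (U x) =
        (∫ x, L x ((w n - U) x) (w n x)) + ∫ x, L x (U x) ((w n - U) x) := by
      rw [← integral_sub hiw hiU, ← integral_add hi1 hi2]
      refine integral_congr_ae (Eventually.of_forall fun x => ?_)
      simp only [Pi.sub_apply, map_sub, _root_.FunLike.coe_sub]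
      ring
    rw [e]
    calc ‖(∫ x, L x ((w n - U) x) (w n x)) + ∫ x, L x (U x) ((w n - U) x)‖
        ≤ ‖∫ x, L x ((w n - U) x) (w n x)‖ + ‖∫ x, L x (U x) ((w n - U) x)‖ := norm_add_le _ _
      _ ≤ M * T n * (eLpNorm (w n) 3 volume).toReal + M * u * T n := add_le_add hb1 hb2
      _ ≤ M * T n * (T n + u) + M * u * T n :=
          add_le_add (mul_le_mul_of_nonneg_left (hwn n)
            (mul_nonneg ENNReal.toReal_nonneg ENNReal.toReal_nonneg)) le_rfl
  have hlim : Tendsto (fun n => M * T n * (T n + u) + M * u * T n) atTop (𝓝 0) := by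
    have h := ((hT'.const_mul M).mul (hT'.add (tendsto_const_nhds (x := u)))).add
      (hT'.const_mul (M * u))
    simpa only [mul_zero, zero_mul, zero_add, add_zero] using h
  exact tendsto_iff_norm_sub_tendsto_zero.2 (squeeze_zero (fun n => norm_nonneg _) hbound hlim)

end Pairings

/-! ## The pressure attached to an `L³` field -/

section Assembly

/-- `‖ |f|² ‖_{3/2} = ‖f‖₃²`. [folklore] -/
theorem eLpNorm_norm_sq_eq_threeHalves {μ : Measure (EuclideanSpace ℝ (Fin 3))}
    (f : EuclideanSpace ℝ (Fin 3) → EuclideanSpace ℝ (Fin 3)) :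
    eLpNorm (fun x => ‖f x‖ ^ 2) (3 / 2) μ = eLpNorm f 3 μ ^ 2 := by
  have h := eLpNorm_norm_rpow f (p := (3 / 2 : ℝ≥0∞)) (μ := μ) (q := 2) two_pos
  have e1 : (fun x => ‖f x‖ ^ (2 : ℝ)) = fun x => ‖f x‖ ^ 2 := by
    funext x; exact Real.rpow_two _
  have e2 : (3 / 2 : ℝ≥0∞) * ENNReal.ofReal 2 = 3 := by
    rw [ENNReal.ofReal_ofNat]; exact ENNReal.div_mul_cancel two_ne_zero ENNReal.ofNat_ne_top
  rw [e1, e2, ENNReal.rpow_two] at h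
  exact h

/-- **The whole-space pressure of an `L³` field, from Stein's bound on test fields.** Assume the
Calderón–Zygmund bound `‖p̃[w]‖_p ≤ C_p ‖|w|²‖_p` for the normalised pressure of test fields
(`stein1970_normalisedPressure_Lp_bound`; Stein 1970, Ch. II §4.2 Thm 3), used at `p = 3/2`.
Then there is a constant `C` such that every `U ∈ L³(ℝ³; ℝ³)` admits `P ∈ L^{3/2}(ℝ³)` with
`‖P‖_{3/2} ≤ C ‖U‖₃²` and `∫ P Δφ = -∫ D²φ(U, U)` for all test functions `φ`, i.e.
`-Δ P = ∂ᵢ∂ⱼ(UᵢUⱼ)` in `𝒟'(ℝ³)`. This is the component `p₁` ("`Δ p₁ = -div div (χ_B u ⊗ u)` in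
`ℝ³`", "`∫_B |p₁|^{3/2} ≤ c ∫_B |u|³`") of the pressure splitting in Seregin's local regularity
theory. Proof: Tsai's approximation argument (Lemma 2.1) in `L³`/`L^{3/2}` — test fields
`wₙ → U` in `L³` (`exists_smooth_seq_tendsto_eLpNorm_withDensity` with weight exponent `0`),
`p̃[wₙ]` Cauchy in `L^{3/2}` by `eLpNorm_normalisedPressure_sub_le` and
`cauchy_of_quadratic_bound`, completeness, and the two pairing limits above.
[cite: Seregin2014, §6.3 (proof of Prop. 3.10)][cite: Seregin2005, (p9)–(p10)]
[cite: Tsai1998, Lemma 2.1 proof (p. 34)] -/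
theorem exists_wholeSpacePressure_of_stein (hS : stein1970_normalisedPressure_Lp_bound) :
    ∃ C : ℝ≥0, ∀ U : EuclideanSpace ℝ (Fin 3) → EuclideanSpace ℝ (Fin 3), MemLp U 3 volume →
      ∃ P : EuclideanSpace ℝ (Fin 3) → ℝ, MemLp P (3 / 2) volume ∧
        eLpNorm P (3 / 2) volume ≤ C * eLpNorm U 3 volume ^ 2 ∧
        ∀ φ : EuclideanSpace ℝ (Fin 3) → ℝ, ContDiff ℝ (⊤ : ℕ∞) φ → HasCompactSupport φ →
          ∫ x, P x * (Δ φ) x = -∫ x, fderiv ℝ (fderiv ℝ φ) x (U x) (U x) := by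
  -- exponents and Stein's constant at `p = 3/2`
  have h32_1 : (1 : ℝ≥0∞) < 3 / 2 := by
    rw [ENNReal.lt_div_iff_mul_lt (Or.inl two_ne_zero) (Or.inl ENNReal.ofNat_ne_top)]; norm_num
  have h32_top : (3 / 2 : ℝ≥0∞) < ⊤ := ENNReal.div_lt_top ENNReal.ofNat_ne_top two_ne_zero
  have h32_1' : (1 : ℝ≥0∞) ≤ 3 / 2 := h32_1.le
  have h3_1 : (1 : ℝ≥0∞) ≤ 3 := by norm_num
  have hT₂ : ENNReal.HolderTriple (3 / 2) 3 1 := by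
    have h23 : (2 : ℝ≥0∞) / 3 + 3⁻¹ = 1 := by
      rw [show (3 : ℝ≥0∞)⁻¹ = 1 / 3 by rw [one_div], ENNReal.div_add_div_same,
        show (2 : ℝ≥0∞) + 1 = 3 by norm_num]
      exact ENNReal.div_self (by norm_num) (by norm_num)
    constructor
    rw [ENNReal.inv_div (Or.inr (by norm_num)) (Or.inr (by norm_num)), inv_one, h23]
  obtain ⟨C, hC⟩ := hS (3 / 2) h32_1 h32_top
  refine ⟨C, fun U hUmem => ?_⟩
  have hUm : AEStronglyMeasurable U volume := hUmem.1
  have hUnorm : eLpNorm U 3 volume ≠ ⊤ := hUmem.eLpNorm_ne_top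
  -- §1: test fields `wₙ → U` in `L³`, normalised so that `‖wₙ − U‖₃ ≤ 1`
  have h0 : (volume.withDensity fun x : EuclideanSpace ℝ (Fin 3) => ‖x‖ₑ ^ (0 : ℝ)) = volume := by
    simp only [ENNReal.rpow_zero]
    exact withDensity_one
  obtain ⟨w₀, hw₀, hT₀⟩ : ∃ w : ℕ → EuclideanSpace ℝ (Fin 3) → EuclideanSpace ℝ (Fin 3),
      (∀ n, ContDiff ℝ ∞ (w n) ∧ HasCompactSupport (w n)) ∧
      Tendsto (fun n => eLpNorm (w n - U) 3 volume) atTop (𝓝 0) := by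
    have h := exists_smooth_seq_tendsto_eLpNorm_withDensity (G := EuclideanSpace ℝ (Fin 3)) (p := 3)
      (by norm_num : (-3 : ℝ) < 0) h3_1 ENNReal.ofNat_ne_top (U := U) (by rw [h0]; exact hUmem)
    rwa [h0] at h
  obtain ⟨N₀, hN₀⟩ := eventually_atTop.1 (hT₀.eventually (gt_mem_nhds zero_lt_one))
  set w : ℕ → EuclideanSpace ℝ (Fin 3) → EuclideanSpace ℝ (Fin 3) := fun n => w₀ (n + N₀)
    with hw_def
  have hw : ∀ n, ContDiff ℝ ∞ (w n) ∧ HasCompactSupport (w n) := fun n => hw₀ (n + N₀)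
  have hT : Tendsto (fun n => eLpNorm (w n - U) 3 volume) atTop (𝓝 0) :=
    hT₀.comp (tendsto_add_atTop_nat N₀)
  have hT1 : ∀ n, eLpNorm (w n - U) 3 volume ≤ 1 := fun n =>
    (hN₀ (n + N₀) (Nat.le_add_left _ _)).le
  have hwc : ∀ n, Continuous (w n) := fun n => (hw n).1.continuous
  have hwmem : ∀ n, MemLp (w n) 3 volume := fun n =>
    (hwc n).memLp_of_hasCompactSupport (hw n).2
  have hwn : ∀ n, eLpNorm (w n) 3 volume ≤ 1 + eLpNorm U 3 volume := fun n => by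
    have e : w n = (w n - U) + U := by abel
    calc eLpNorm (w n) 3 volume = eLpNorm ((w n - U) + U) 3 volume := by rw [← e]
      _ ≤ eLpNorm (w n - U) 3 volume + eLpNorm U 3 volume :=
          eLpNorm_add_le ((hwc n).aestronglyMeasurable.sub hUm) hUm h3_1
      _ ≤ 1 + eLpNorm U 3 volume := add_le_add (hT1 n) le_rfl
  -- §2: the normalised pressures `Pₙ = p̃[wₙ]` and their `L^{3/2}` bounds
  set P : ℕ → EuclideanSpace ℝ (Fin 3) → ℝ := fun n => normalisedPressure (w n) with hP_def
  have hPc : ∀ n, Continuous (P n) := fun n =>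
    continuous_normalisedPressure_of_hasCompactSupport (hw n).1 (hw n).2
  have hPbound : ∀ n, eLpNorm (P n) (3 / 2) volume ≤ C * eLpNorm (w n) 3 volume ^ 2 := fun n => by
    rw [← eLpNorm_norm_sq_eq_threeHalves]
    exact hC (w n) (hw n).1 (hw n).2
  have hPmem : ∀ n, MemLp (P n) (3 / 2) volume := fun n => by
    refine ⟨(hPc n).aestronglyMeasurable, (hPbound n).trans_lt ?_⟩
    refine ENNReal.mul_lt_top ENNReal.coe_lt_top (ENNReal.pow_lt_top ?_)
    exact (hwn n).trans_lt (ENNReal.add_lt_top.2 ⟨ENNReal.one_lt_top, hUnorm.lt_top⟩)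
  -- §3: `Pₙ` is Cauchy in `L^{3/2}` (polarisation bound)
  set B : ℝ≥0∞ := (2 * (1 + eLpNorm U 3 volume)) ^ 2 with hB_def
  have hBtop : B ≠ ⊤ := ENNReal.pow_ne_top (ENNReal.mul_ne_top (by norm_num)
    (ENNReal.add_ne_top.2 ⟨ENNReal.one_ne_top, hUnorm⟩))
  have hD : ∀ t : ℝ, 0 < t → ∀ n m, eLpNorm (P n - P m) (3 / 2) volume ≤
      4 * C * (ENNReal.ofReal (t ^ 2) *
        (eLpNorm (w n - U) 3 volume + eLpNorm (w m - U) 3 volume) ^ 2 +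
        ENNReal.ofReal (t⁻¹ ^ 2) * B) := by
    intro t ht n m
    have hbil := eLpNorm_normalisedPressure_sub_le (μ := volume) (p := 3 / 2) (C := C) hC h32_1'
      (hw n).1 (hw n).2 (hw m).1 (hw m).2 ht
    refine hbil.trans ?_
    rw [eLpNorm_norm_sq_eq_threeHalves, eLpNorm_norm_sq_eq_threeHalves, hB_def]
    gcongr
    · -- `‖wₙ − wₘ‖ ≤ ‖wₙ − U‖ + ‖wₘ − U‖`
      have e : w n - w m = (w n - U) + (U - w m) := by abel
      calc eLpNorm (w n - w m) 3 volume = eLpNorm ((w n - U) + (U - w m)) 3 volume := by rw [← e]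
        _ ≤ eLpNorm (w n - U) 3 volume + eLpNorm (U - w m) 3 volume :=
            eLpNorm_add_le ((hwc n).aestronglyMeasurable.sub hUm)
              (hUm.sub (hwc m).aestronglyMeasurable) h3_1
        _ = eLpNorm (w n - U) 3 volume + eLpNorm (w m - U) 3 volume := by rw [eLpNorm_sub_comm U]
    · -- `‖wₙ + wₘ‖ ≤ 2 (1 + ‖U‖)`
      calc eLpNorm (w n + w m) 3 volume ≤ eLpNorm (w n) 3 volume + eLpNorm (w m) 3 volume :=
            eLpNorm_add_le (hwc n).aestronglyMeasurable (hwc m).aestronglyMeasurable h3_1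
        _ ≤ (1 + eLpNorm U 3 volume) + (1 + eLpNorm U 3 volume) := add_le_add (hwn n) (hwn m)
        _ = 2 * (1 + eLpNorm U 3 volume) := by rw [two_mul]
  have hA : (4 : ℝ≥0∞) * C ≠ ⊤ := ENNReal.mul_ne_top (by norm_num) ENNReal.coe_ne_top
  have hCauchy := cauchy_of_quadratic_bound hA hBtop hT hD
  -- §4: the limit `Q`
  obtain ⟨Q, hQmem, hE⟩ := exists_memLp_tendsto_eLpNorm_sub_of_cauchy h32_1' hPmem hCauchy
  refine ⟨Q, hQmem, ?_, ?_⟩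
  · -- §5: the norm bound passes to the limit
    have hwlim : Tendsto (fun n => eLpNorm (w n) 3 volume) atTop (𝓝 (eLpNorm U 3 volume)) :=
      tendsto_eLpNorm_of_tendsto_eLpNorm_sub h3_1 (fun n => (hwc n).aestronglyMeasurable) hUm hT
    have hstep : ∀ n, eLpNorm Q (3 / 2) volume ≤
        eLpNorm (P n - Q) (3 / 2) volume + C * eLpNorm (w n) 3 volume ^ 2 := by
      intro n
      have e : Q = (Q - P n) + P n := by abel
      calc eLpNorm Q (3 / 2) volume = eLpNorm ((Q - P n) + P n) (3 / 2) volume := by rw [← e]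
        _ ≤ eLpNorm (Q - P n) (3 / 2) volume + eLpNorm (P n) (3 / 2) volume :=
            eLpNorm_add_le (hQmem.1.sub (hPc n).aestronglyMeasurable)
              (hPc n).aestronglyMeasurable h32_1'
        _ ≤ eLpNorm (P n - Q) (3 / 2) volume + C * eLpNorm (w n) 3 volume ^ 2 := by
            rw [eLpNorm_sub_comm]; exact add_le_add le_rfl (hPbound n)
    have hlim : Tendsto (fun n => eLpNorm (P n - Q) (3 / 2) volume + C * eLpNorm (w n) 3 volume ^ 2)
        atTop (𝓝 (0 + C * eLpNorm U 3 volume ^ 2)) :=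
      hE.add (ENNReal.Tendsto.const_mul (((ENNReal.continuous_pow 2).tendsto _).comp hwlim)
        (Or.inr ENNReal.coe_ne_top))
    have h := le_of_tendsto_of_tendsto' tendsto_const_nhds hlim hstep
    rwa [zero_add] at h
  · -- §6: the distributional equation passes to the limit in both pairings
    intro φ hφ hφc
    have hφ2 : ContDiff ℝ 2 φ := contDiff_infty.1 hφ 2
    have hΔc : Continuous (Δ φ) := FluidPDE.continuous_laplacian hφ2
    have hΔs : HasCompactSupport (Δ φ) :=
      hφc.mono' fun x hx => by
        contrapose! hx
        simp [FluidPDE.laplacian_eq_zero_of_notMem_tsupport hx]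
    have hΔmem : MemLp (Δ φ) 3 volume := hΔc.memLp_of_hasCompactSupport hΔs
    have h1 : Tendsto (fun n => ∫ x, P n x * (Δ φ) x) atTop (𝓝 (∫ x, Q x * (Δ φ) x)) :=
      tendsto_integral_mul_of_tendsto_eLpNorm_sub hPmem hQmem hE hΔmem
    have h2 : Tendsto (fun n => ∫ x, P n x * (Δ φ) x) atTop
        (𝓝 (-∫ x, fderiv ℝ (fderiv ℝ φ) x (U x) (U x))) := by
      have h := (tendsto_integral_hessian_apply_of_tendsto_eLpNorm hwmem hUmem hT hφ hφc).neg
      refine h.congr fun n => ?_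
      exact (integral_normalisedPressure_mul_laplacian_eq_neg (hw n).1 (hw n).2 hφ hφc).symm
    exact tendsto_nhds_unique h1 h2

end Assembly

end Literature.Analysis.FluidPDE

end
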